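import Literature.GroupTheory.ArithmeticGroups.SL2TwoPowDoubleLayer
import Literature.GroupTheory.ArithmeticGroups.SL2PrimePowCentralExtensionLayer
import Mathlib.Algebra.Group.Conj
import Mathlib.GroupTheory.Commutator.Basic
import HarnessLib

/-!
# Central extensions of `SL₂(ℤ/2^e)`: the double layer and the canonical complement of squares

Let `π : E ↠ SL₂(ℤ/2^e)` be a central extension whose kernel has exponent `2`, `e ≥ 5`, and let `t, l ∈ E` lift
`T̄ = (1 1; 0 1)`, `L̄ = (1 0; 1 1)`.  Put `a = 2^{e-2}`, `e_h = t^a`, `f_h = l^a`, `x_h = t f_h t⁻¹` (lifts of the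
generators `T̄^a, L̄^a, X̄_a` of the double layer `U₂ = ker(SL₂(ℤ/2^e) → SL₂(ℤ/2^{e-2})) ≅ (ℤ/4)³`).  We prove,
in hypothesis form:
* `e_h, f_h, x_h` commute pairwise (`[t^a, l^a] = [t^a, l⁴]^{a/4}` with `[t^a, l⁴]` central and `a/4` even —
  this is where `e ≥ 5` enters), hence the preimage `A₂ = π⁻¹(U₂)` is ABELIAN (`comm_of_double_layer`);
* every element of `A₂` is `e_h^i f_h^j x_h^k z` with `z ∈ ker π` (`exists_decomp₂`), every element of the
  top-layer preimage is `(e_h²)^b h₀^a (f_h²)^c z` with `h₀ = x_h² e_h² f_h⁻²` (`exists_decomp₁`);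
* `l^{2^e} = (t^{2^e})⁻¹` (`S̄`-symmetry) and the key computation: **a square `x²`, `x ∈ A₂`, lying in `ker π`
  is a power of `τ = t^{2^e}`** (`sq_mem_zpowers`).
Consequently the set `W` of squares of `A₂` is a normal subgroup with `π(W)` = top layer and `W ∩ ker π ⊆ ⟨τ⟩`
— the canonical complement used in the `2`-adic descent (`SL2TwoPowSchurMultiplier`).  No cocycle constant
has to be determined: this is the `2`-adic counterpart of [Beyl1986] (Schur multiplier of `SL₂(ℤ/2^e)`), cf.
[CalegariDimitrovTang2025, §4.5, Lemma 4.5.9] (`H²(G(4)) → H²(G(8))` vanishes).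
-/

open scoped MatrixGroups commutatorElement

namespace Literature.GroupTheory.ArithmeticGroups

namespace SL2TwoPowCentralExtension

open Matrix.SpecialLinearGroup

/-- If the commutator `⁅x, y⁆` is central then `⁅x, yⁿ⁆ = ⁅x, y⁆ⁿ`. [cite: Rotman1995, Theorem 5.1 (commutator
identities)] -/
theorem commutatorElement_pow_right {G : Type*} [Group G] {x y : G} (hc : ∀ g : G, g * ⁅x, y⁆ = ⁅x, y⁆ * g)
    (n : ℕ) : ⁅x, y ^ n⁆ = ⁅x, y⁆ ^ n := by
  have h1 : x * y ^ n * x⁻¹ = (x * y * x⁻¹) ^ n := conj_pow.symm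
  have h2 : x * y * x⁻¹ = ⁅x, y⁆ * y := by rw [commutatorElement_def]; group
  have hcomm : Commute ⁅x, y⁆ y := (hc y).symm
  rw [commutatorElement_def x (y ^ n), h1, h2, hcomm.mul_pow, mul_inv_cancel_right]

variable {e : ℕ} {E : Type*} [Group E] {π : E →* SL(2, ZMod (2 ^ e))}

section images

variable {t l eh fh xh : E} (heh : eh = t ^ 2 ^ (e - 2)) (hfh : fh = l ^ 2 ^ (e - 2)) (hxh : xh = t * fh * t⁻¹)
  (ht : ((π t : SL(2, ZMod (2 ^ e))) : Matrix (Fin 2) (Fin 2) (ZMod (2 ^ e))) = !![1, 1; 0, 1])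
  (hl : ((π l : SL(2, ZMod (2 ^ e))) : Matrix (Fin 2) (Fin 2) (ZMod (2 ^ e))) = !![1, 0; 1, 1])

include heh ht in
/-- Image of `e_h = t^{2^{e-2}}`: `T̄_a = (1 a; 0 1)`, `a = 2^{e-2}`. [cite: CalegariDimitrovTang2025, §4.5, Lemma
4.5.9] -/
theorem coe_map_eh : ((π eh : SL(2, ZMod (2 ^ e))) : Matrix (Fin 2) (Fin 2) (ZMod (2 ^ e))) =
    !![1, (2 : ZMod (2 ^ e)) ^ (e - 2); 0, 1] := by
  rw [heh, map_pow, SL2TopLayer.tBar_pow _ ht, Nat.cast_pow, Nat.cast_ofNat]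

include hfh hl in
/-- Image of `f_h = l^{2^{e-2}}`: `L̄_a = (1 0; a 1)`. [cite: CalegariDimitrovTang2025, §4.5, Lemma 4.5.9] -/
theorem coe_map_fh : ((π fh : SL(2, ZMod (2 ^ e))) : Matrix (Fin 2) (Fin 2) (ZMod (2 ^ e))) =
    !![1, 0; (2 : ZMod (2 ^ e)) ^ (e - 2), 1] := by
  rw [hfh, map_pow, SL2TopLayer.lBar_pow _ hl, Nat.cast_pow, Nat.cast_ofNat]

include hfh hxh ht hl in
/-- Image of `x_h = t f_h t⁻¹`: `X̄_a = (1+a -a; a 1-a)`. [cite: CalegariDimitrovTang2025, §4.5, Lemma 4.5.9] -/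
theorem coe_map_xh : ((π xh : SL(2, ZMod (2 ^ e))) : Matrix (Fin 2) (Fin 2) (ZMod (2 ^ e))) =
    !![1 + (2 : ZMod (2 ^ e)) ^ (e - 2), -(2 : ZMod (2 ^ e)) ^ (e - 2);
       (2 : ZMod (2 ^ e)) ^ (e - 2), 1 - (2 : ZMod (2 ^ e)) ^ (e - 2)] := by
  rw [hxh, map_mul, map_mul, map_inv]
  exact SL2DoubleLayer.tBar_conj_la _ (π t) (π fh) ht (coe_map_fh hfh hl)

include heh ht in
/-- Image of `e_h²`: the top-layer generator `(1 ϖ; 0 1)`, `ϖ = 2^{e-1}` (`e ≥ 2`). [cite: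
CalegariDimitrovTang2025, §4.5, Lemma 4.5.9] -/
theorem coe_map_eh_sq (he : 2 ≤ e) : ((π (eh ^ 2) : SL(2, ZMod (2 ^ e))) : Matrix (Fin 2) (Fin 2) (ZMod (2 ^ e))) =
    !![1, (2 : ZMod (2 ^ e)) ^ (e - 1); 0, 1] := by
  rw [map_pow, SL2TopLayer.eBar_pow _ (π eh) (coe_map_eh heh ht) 2, Nat.cast_ofNat,
    SL2DoubleLayer.two_mul_a e he]

include hfh hl in
/-- Image of `f_h²`: `(1 0; ϖ 1)`. [cite: CalegariDimitrovTang2025, §4.5, Lemma 4.5.9] -/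
theorem coe_map_fh_sq (he : 2 ≤ e) : ((π (fh ^ 2) : SL(2, ZMod (2 ^ e))) : Matrix (Fin 2) (Fin 2) (ZMod (2 ^ e))) =
    !![1, 0; (2 : ZMod (2 ^ e)) ^ (e - 1), 1] := by
  rw [map_pow, SL2TopLayer.fBar_pow _ (π fh) (coe_map_fh hfh hl) 2, Nat.cast_ofNat,
    SL2DoubleLayer.two_mul_a e he]

include heh hfh hxh ht hl in
/-- Image of `h₀ = x_h² e_h² f_h⁻²`: the diagonal top-layer generator `(1+ϖ 0; 0 1-ϖ)` (`e ≥ 4`). [cite: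
CalegariDimitrovTang2025, §4.5, Lemma 4.5.9] -/
theorem coe_map_h₀ (he : 4 ≤ e) :
    ((π (xh ^ 2 * eh ^ 2 * (fh ^ 2)⁻¹) : SL(2, ZMod (2 ^ e))) : Matrix (Fin 2) (Fin 2) (ZMod (2 ^ e))) =
    !![1 + (2 : ZMod (2 ^ e)) ^ (e - 1), 0; 0, 1 - (2 : ZMod (2 ^ e)) ^ (e - 1)] := by
  rw [map_mul, map_mul, map_inv, map_pow, map_pow, map_pow,
    SL2DoubleLayer.xa_sq_mul_ta_sq_mul_la_sq_inv _ (π eh) (π fh) (π xh) (SL2DoubleLayer.a_mul_a e he)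
      (coe_map_eh heh ht) (coe_map_fh hfh hl) (coe_map_xh hfh hxh ht hl),
    SL2DoubleLayer.two_mul_a e (by omega)]

include heh ht in
/-- `e_h` lies over the double layer: its reduction modulo `2^{e-2}` is trivial. [cite: CalegariDimitrovTang2025,
§4.5, Lemma 4.5.9] -/
theorem layer₂_eh : Matrix.SpecialLinearGroup.map (ZMod.castHom (pow_dvd_pow 2 (Nat.sub_le e 2))
    (ZMod (2 ^ (e - 2)))) (π eh) = 1 := by
  have hcast : ZMod.castHom (pow_dvd_pow 2 (Nat.sub_le e 2)) (ZMod (2 ^ (e - 2))) ((2 : ZMod (2 ^ e)) ^ (e - 2)) = 0 := by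
    rw [map_pow, map_ofNat]
    have : ((2 ^ (e - 2) : ℕ) : ZMod (2 ^ (e - 2))) = 0 := ZMod.natCast_self _
    exact_mod_cast this
  ext i j; fin_cases i <;> fin_cases j <;>
    simp [coe_map_eh heh ht, -ZMod.castHom_apply, map_one, hcast]

end images

section commute

variable (hcen : ∀ z : E, π z = 1 → ∀ g : E, g * z = z * g) (hK2 : ∀ z : E, π z = 1 → z ^ 2 = 1)
variable {t l eh fh xh : E} (heh : eh = t ^ 2 ^ (e - 2)) (hfh : fh = l ^ 2 ^ (e - 2)) (hxh : xh = t * fh * t⁻¹)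
  (ht : ((π t : SL(2, ZMod (2 ^ e))) : Matrix (Fin 2) (Fin 2) (ZMod (2 ^ e))) = !![1, 1; 0, 1])
  (hl : ((π l : SL(2, ZMod (2 ^ e))) : Matrix (Fin 2) (Fin 2) (ZMod (2 ^ e))) = !![1, 0; 1, 1])

include hcen heh ht hl in
/-- The commutator `[e_h, l⁴]` lies in the central kernel (`[T̄_a, L̄⁴] = 1` as `4a = 0`). [cite: Beyl1986,
Theorem (Schur multiplier of SL(2,ℤ/m)), 2-primary part] -/
theorem comm_eh_l4_central (he : 4 ≤ e) (g : E) : g * ⁅eh, l ^ 4⁆ = ⁅eh, l ^ 4⁆ * g := by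
  refine hcen _ ?_ g
  rw [commutatorElement_def, map_mul, map_mul, map_mul, map_inv, map_inv, map_pow]
  exact SL2DoubleLayer.ta_comm_lBar_pow_four _ (π l) (π eh) (SL2DoubleLayer.four_mul_a e (by omega)) hl
    (coe_map_eh heh ht)

include hcen hK2 heh hfh ht hl in
/-- **`e_h` and `f_h` commute** (`e ≥ 5`): `[t^a, l^a] = [t^a, l⁴]^{a/4}`, the commutator `[t^a, l⁴]` is central of
order `≤ 2` and `a/4 = 2^{e-4}` is even. [cite: Beyl1986, Theorem (Schur multiplier of SL(2,ℤ/m)), 2-primary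
part] -/
theorem commute_eh_fh (he : 5 ≤ e) : Commute eh fh := by
  have hc := comm_eh_l4_central hcen heh ht hl (by omega)
  have hπc : π ⁅eh, l ^ 4⁆ = 1 := by
    rw [commutatorElement_def, map_mul, map_mul, map_mul, map_inv, map_inv, map_pow]
    exact SL2DoubleLayer.ta_comm_lBar_pow_four _ (π l) (π eh) (SL2DoubleLayer.four_mul_a e (by omega)) hl
      (coe_map_eh heh ht)
  have hpow : fh = (l ^ 4) ^ (2 * 2 ^ (e - 5)) := by
    rw [hfh, ← pow_mul]
    congr 1
    rw [show e - 2 = e - 5 + 3 by omega, pow_add]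
    ring
  rw [← commutatorElement_eq_one_iff_commute, hpow, commutatorElement_pow_right hc, pow_mul, hK2 _ hπc,
    one_pow]

include hcen hK2 heh hfh hxh ht hl in
/-- `e_h` and `x_h = t f_h t⁻¹` commute (conjugate the previous relation by `t`). [cite: Beyl1986, Theorem
(Schur multiplier of SL(2,ℤ/m)), 2-primary part] -/
theorem commute_eh_xh (he : 5 ≤ e) : Commute eh xh := by
  have het : Commute eh t := by rw [heh]; exact (Commute.refl t).pow_left _
  rw [hxh]
  exact (het.mul_right (commute_eh_fh hcen hK2 heh hfh ht hl he)).mul_right het.inv_right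

include hcen hK2 heh hfh hxh ht hl in
/-- `f_h` and `x_h` commute: `l e_h l⁻¹` is a lift of `X̄_a⁻¹`, so `x_h = (l e_h l⁻¹)⁻¹ u` with `u` central, and
`f_h` commutes with `l e_h l⁻¹`. [cite: Beyl1986, Theorem (Schur multiplier of SL(2,ℤ/m)), 2-primary part] -/
theorem commute_fh_xh (he : 5 ≤ e) : Commute fh xh := by
  set y : E := l * eh * l⁻¹ with hy
  have hu : π (y * xh) = 1 := by
    rw [hy, map_mul, map_mul, map_mul, map_inv]
    exact SL2DoubleLayer.lBar_conj_ta_mul_xa _ (π l) (π eh) (π xh) hl (coe_map_eh heh ht)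
      (coe_map_xh hfh hxh ht hl)
  have hxy : xh = y⁻¹ * (y * xh) := by group
  have hfl : Commute fh l := by rw [hfh]; exact (Commute.refl l).pow_left _
  have hfy : Commute fh y := by
    rw [hy]
    exact (hfl.mul_right (commute_eh_fh hcen hK2 heh hfh ht hl he).symm).mul_right hfl.inv_right
  have hfu : Commute fh (y * xh) := (hcen _ hu fh)
  rw [hxy]
  exact hfy.inv_right.mul_right hfu

include heh hfh hxh ht hl in
/-- Every element of the double-layer preimage is `e_h^i f_h^j x_h^k z` with `z ∈ ker π` (`e ≥ 4`). [cite: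
CalegariDimitrovTang2025, §4.5, Lemma 4.5.9] -/
theorem exists_decomp₂ (he : 4 ≤ e) {x : E}
    (hx : Matrix.SpecialLinearGroup.map (ZMod.castHom (pow_dvd_pow 2 (Nat.sub_le e 2)) (ZMod (2 ^ (e - 2))))
      (π x) = 1) :
    ∃ (i j k : ℕ) (z : E), π z = 1 ∧ x = eh ^ i * fh ^ j * xh ^ k * z := by
  obtain ⟨i, j, k, hijk⟩ := SL2DoubleLayer.exists_eq_pow_mul_pow_mul_pow₂ e he (π eh) (π fh) (π xh)
    (coe_map_eh heh ht) (coe_map_fh hfh hl) (coe_map_xh hfh hxh ht hl) hx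
  obtain ⟨z, hz, hxz⟩ := SL2CentralExtension.exists_eq_mul_of_map_eq (π := π) (x := x)
    (y := eh ^ i * fh ^ j * xh ^ k) (by rw [hijk, map_mul, map_mul, map_pow, map_pow, map_pow])
  exact ⟨i, j, k, z, hz, hxz⟩

include hcen hK2 heh hfh hxh ht hl in
/-- A generator commutes with every `e_h^i f_h^j x_h^k z`, `z ∈ ker π`. [cite: Beyl1986, Theorem (Schur
multiplier of SL(2,ℤ/m)), 2-primary part] -/
theorem commute_decomp (he : 5 ≤ e) {u : E} (hu : u = eh ∨ u = fh ∨ u = xh) (i j k : ℕ) {z : E}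
    (hz : π z = 1) : Commute u (eh ^ i * fh ^ j * xh ^ k * z) := by
  have hef := commute_eh_fh hcen hK2 heh hfh ht hl he
  have hex := commute_eh_xh hcen hK2 heh hfh hxh ht hl he
  have hfx := commute_fh_xh hcen hK2 heh hfh hxh ht hl he
  have huz : Commute u z := (hcen z hz u)
  rcases hu with rfl | rfl | rfl
  · exact ((((Commute.refl u).pow_right i).mul_right (hef.pow_right j)).mul_right (hex.pow_right k)).mul_right huz
  · exact ((((hef.symm).pow_right i).mul_right ((Commute.refl u).pow_right j)).mul_right
      (hfx.pow_right k)).mul_right huz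
  · exact ((((hex.symm).pow_right i).mul_right (hfx.symm.pow_right j)).mul_right
      ((Commute.refl u).pow_right k)).mul_right huz

include hcen hK2 heh hfh hxh ht hl in
/-- **The preimage of the double layer is abelian** (`e ≥ 5`, kernel of exponent `2`). [cite: Beyl1986, Theorem
(Schur multiplier of SL(2,ℤ/m)), 2-primary part] -/
theorem comm_of_double_layer (he : 5 ≤ e) {x y : E}
    (hx : Matrix.SpecialLinearGroup.map (ZMod.castHom (pow_dvd_pow 2 (Nat.sub_le e 2)) (ZMod (2 ^ (e - 2))))
      (π x) = 1)
    (hy : Matrix.SpecialLinearGroup.map (ZMod.castHom (pow_dvd_pow 2 (Nat.sub_le e 2)) (ZMod (2 ^ (e - 2))))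
      (π y) = 1) :
    x * y = y * x := by
  obtain ⟨i, j, k, z, hz, rfl⟩ := exists_decomp₂ heh hfh hxh ht hl (by omega) hx
  obtain ⟨i', j', k', z', hz', rfl⟩ := exists_decomp₂ heh hfh hxh ht hl (by omega) hy
  have h1 : Commute eh (eh ^ i' * fh ^ j' * xh ^ k' * z') :=
    commute_decomp hcen hK2 heh hfh hxh ht hl he (Or.inl rfl) i' j' k' hz'
  have h2 : Commute fh (eh ^ i' * fh ^ j' * xh ^ k' * z') :=
    commute_decomp hcen hK2 heh hfh hxh ht hl he (Or.inr (Or.inl rfl)) i' j' k' hz'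
  have h3 : Commute xh (eh ^ i' * fh ^ j' * xh ^ k' * z') :=
    commute_decomp hcen hK2 heh hfh hxh ht hl he (Or.inr (Or.inr rfl)) i' j' k' hz'
  have h4 : Commute z (eh ^ i' * fh ^ j' * xh ^ k' * z') := (hcen z hz _).symm
  exact (((h1.pow_left i).mul_left (h2.pow_left j)).mul_left (h3.pow_left k)).mul_left h4

include hcen hK2 heh hfh hxh ht hl in
/-- The square of `e_h^i f_h^j x_h^k z` (`z ∈ ker π`) is `e_h^{2i} f_h^{2j} x_h^{2k}`. [cite: Beyl1986, Theorem
(Schur multiplier of SL(2,ℤ/m)), 2-primary part] -/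
theorem sq_decomp (he : 5 ≤ e) (i j k : ℕ) {z : E} (hz : π z = 1) :
    (eh ^ i * fh ^ j * xh ^ k * z) * (eh ^ i * fh ^ j * xh ^ k * z) =
      eh ^ (2 * i) * fh ^ (2 * j) * xh ^ (2 * k) := by
  have hef := commute_eh_fh hcen hK2 heh hfh ht hl he
  have hex := commute_eh_xh hcen hK2 heh hfh hxh ht hl he
  have hfx := commute_fh_xh hcen hK2 heh hfh hxh ht hl he
  have hz2 : z * z = 1 := by rw [← pow_two]; exact hK2 z hz
  have hzc : ∀ g : E, Commute z g := fun g ↦ (hcen z hz g).symm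
  -- move the two `z`'s together and cancel them
  have h1 : (eh ^ i * fh ^ j * xh ^ k * z) * (eh ^ i * fh ^ j * xh ^ k * z) =
      (eh ^ i * fh ^ j * xh ^ k) * (eh ^ i * fh ^ j * xh ^ k) * (z * z) := by
    have := (hzc (eh ^ i * fh ^ j * xh ^ k)).eq
    calc (eh ^ i * fh ^ j * xh ^ k * z) * (eh ^ i * fh ^ j * xh ^ k * z)
        = (eh ^ i * fh ^ j * xh ^ k) * (z * (eh ^ i * fh ^ j * xh ^ k)) * z := by group
      _ = (eh ^ i * fh ^ j * xh ^ k) * ((eh ^ i * fh ^ j * xh ^ k) * z) * z := by rw [this]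
      _ = (eh ^ i * fh ^ j * xh ^ k) * (eh ^ i * fh ^ j * xh ^ k) * (z * z) := by group
  have hAB : Commute (eh ^ i) (fh ^ j) := hef.pow_pow i j
  have hAC : Commute (eh ^ i) (xh ^ k) := hex.pow_pow i k
  have hBC : Commute (fh ^ j) (xh ^ k) := hfx.pow_pow j k
  rw [h1, hz2, mul_one, ← pow_two, (hAC.mul_left hBC).mul_pow, hAB.mul_pow, ← pow_mul, ← pow_mul, ← pow_mul,
    mul_comm i 2, mul_comm j 2, mul_comm k 2]

end commute

section tau

variable (hcen : ∀ z : E, π z = 1 → ∀ g : E, g * z = z * g) (hK2 : ∀ z : E, π z = 1 → z ^ 2 = 1)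
variable {t l eh fh xh : E} (heh : eh = t ^ 2 ^ (e - 2)) (hfh : fh = l ^ 2 ^ (e - 2)) (hxh : xh = t * fh * t⁻¹)
  (ht : ((π t : SL(2, ZMod (2 ^ e))) : Matrix (Fin 2) (Fin 2) (ZMod (2 ^ e))) = !![1, 1; 0, 1])
  (hl : ((π l : SL(2, ZMod (2 ^ e))) : Matrix (Fin 2) (Fin 2) (ZMod (2 ^ e))) = !![1, 0; 1, 1])

include ht in
/-- `τ := t^{2^e}` lies in the kernel: `T̄^{2^e} = 1` in `SL₂(ℤ/2^e)`. [cite: CalegariDimitrovTang2025, §4.5, Lemma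
4.5.9] -/
theorem map_tau : π (t ^ 2 ^ e) = 1 := by
  apply Subtype.ext
  rw [map_pow, SL2TopLayer.tBar_pow _ ht]
  ext i j; fin_cases i <;> fin_cases j <;> simp

include hl in
/-- `l^{2^e}` lies in the kernel. [cite: CalegariDimitrovTang2025, §4.5, Lemma 4.5.9] -/
theorem map_lpow : π (l ^ 2 ^ e) = 1 := by
  apply Subtype.ext
  rw [map_pow, SL2TopLayer.lBar_pow _ hl]
  ext i j; fin_cases i <;> fin_cases j <;> simp

include hcen hK2 ht hl in
/-- **`S̄`-symmetry**: `l^{2^e} = (t^{2^e})⁻¹`.  With `s = t⁻¹ l t⁻¹` (a lift of `S̄`), `s t s⁻¹ = u l⁻¹` with `u`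
central of order `≤ 2`; raise to the (even) power `2^e`. [cite: Beyl1986, Theorem (Schur multiplier of
SL(2,ℤ/m)), 2-primary part] -/
theorem lpow_eq_tau_inv (he : 1 ≤ e) : l ^ 2 ^ e = (t ^ 2 ^ e)⁻¹ := by
  set s : E := t⁻¹ * l * t⁻¹ with hs
  have key := SL2TopLayer.sBar_conj_tBar (π t) (π l) ht hl
  have hst : π (s * t * s⁻¹) = (π l)⁻¹ := by
    rw [hs]; simpa only [map_mul, map_inv] using key
  have hu : π (s * t * s⁻¹ * l) = 1 := by rw [map_mul, hst, inv_mul_cancel]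
  set u : E := s * t * s⁻¹ * l with hudef
  have hstu : s * t * s⁻¹ = u * l⁻¹ := by rw [hudef]; group
  have huc : Commute u l⁻¹ := (hcen u hu l⁻¹).symm
  have hu2 : u ^ 2 ^ e = 1 := by
    obtain ⟨k, hk⟩ := Nat.exists_eq_add_of_le he
    rw [hk, show 1 + k = k + 1 from add_comm 1 k, pow_succ, pow_mul', hK2 u hu, one_pow]
  have h1 : (s * t * s⁻¹) ^ 2 ^ e = t ^ 2 ^ e := by
    rw [conj_pow, hcen _ (map_tau ht) s, mul_assoc, mul_inv_cancel, mul_one]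
  rw [hstu, huc.mul_pow, hu2, one_mul, inv_pow] at h1
  rw [← h1, inv_inv]

include hcen hK2 heh hfh hxh ht hl in
/-- **The key computation.**  If `x` lies over the double layer and `x² ∈ ker π`, then `x²` is a power of
`τ = t^{2^e}` (`e ≥ 5`): writing `x = e_h^i f_h^j x_h^k z`, `x² = e_h^{2i} f_h^{2j} x_h^{2k}` maps to
`T̄_a^{2i} L̄_a^{2j} X̄_a^{2k} = 1`, so `i, j, k` are even, and `e_h⁴ = τ`, `f_h⁴ = l^{2^e} = τ⁻¹`, `x_h⁴ = t f_h⁴ t⁻¹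
= τ⁻¹`. [cite: Beyl1986, Theorem (Schur multiplier of SL(2,ℤ/m)), 2-primary part] -/
theorem sq_mem_zpowers (he : 5 ≤ e) {x : E}
    (hx : Matrix.SpecialLinearGroup.map (ZMod.castHom (pow_dvd_pow 2 (Nat.sub_le e 2)) (ZMod (2 ^ (e - 2))))
      (π x) = 1)
    (h1 : π (x * x) = 1) : x * x ∈ Subgroup.zpowers (t ^ 2 ^ e) := by
  obtain ⟨i, j, k, z, hz, rfl⟩ := exists_decomp₂ heh hfh hxh ht hl (by omega) hx
  rw [sq_decomp hcen hK2 heh hfh hxh ht hl he i j k hz] at h1 ⊢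
  have h2 : π eh ^ (2 * i) * π fh ^ (2 * j) * π xh ^ (2 * k) = 1 := by
    rw [← map_pow, ← map_pow, ← map_pow, ← map_mul, ← map_mul]; exact h1
  obtain ⟨⟨i', rfl⟩, ⟨j', rfl⟩, ⟨k', rfl⟩⟩ := SL2DoubleLayer.even_of_pow_mul_pow_mul_pow_eq_one e (by omega)
    (π eh) (π fh) (π xh) (coe_map_eh heh ht) (coe_map_fh hfh hl) (coe_map_xh hfh hxh ht hl) h2
  have hpow : 2 ^ (e - 2) * (2 * (2 * 1)) = 2 ^ e := by
    rw [show e = e - 2 + 2 by omega, pow_add]; norm_num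
  have heh4 : ∀ n : ℕ, eh ^ (2 * (2 * n)) = (t ^ 2 ^ e) ^ n := by
    intro n
    rw [heh, ← pow_mul, ← pow_mul, show 2 ^ (e - 2) * (2 * (2 * n)) = 2 ^ (e - 2) * (2 * (2 * 1)) * n by ring,
      hpow]
  have hfh4 : ∀ n : ℕ, fh ^ (2 * (2 * n)) = (l ^ 2 ^ e) ^ n := by
    intro n
    rw [hfh, ← pow_mul, ← pow_mul, show 2 ^ (e - 2) * (2 * (2 * n)) = 2 ^ (e - 2) * (2 * (2 * 1)) * n by ring,
      hpow]
  have hxh4 : ∀ n : ℕ, xh ^ (2 * (2 * n)) = (l ^ 2 ^ e) ^ n := by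
    intro n
    rw [hxh, conj_pow, hfh4 n, hcen _ (by rw [map_pow, map_lpow hl, one_pow]) t, mul_assoc, mul_inv_cancel,
      mul_one]
  rw [heh4, hfh4, hxh4, lpow_eq_tau_inv hcen hK2 ht hl (by omega), inv_pow, inv_pow]
  exact mul_mem (mul_mem (Subgroup.npow_mem_zpowers (t ^ 2 ^ e) i')
    (inv_mem (Subgroup.npow_mem_zpowers (t ^ 2 ^ e) j'))) (inv_mem (Subgroup.npow_mem_zpowers (t ^ 2 ^ e) k'))

include heh hfh hxh ht hl in
/-- Every element of the preimage of the TOP layer is `(e_h²)^b h₀^a (f_h²)^c z` with `z ∈ ker π`, where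
`h₀ = x_h² e_h² f_h⁻²` (`e ≥ 4`). [cite: CalegariDimitrovTang2025, §4.5, Lemma 4.5.9] -/
theorem exists_decomp₁ (he : 4 ≤ e) {x : E}
    (hx : Matrix.SpecialLinearGroup.map (ZMod.castHom (pow_dvd_pow 2 (Nat.sub_le e 1)) (ZMod (2 ^ (e - 1))))
      (π x) = 1) :
    ∃ (a b c : ℕ) (z : E), π z = 1 ∧ x = (eh ^ 2) ^ b * (xh ^ 2 * eh ^ 2 * (fh ^ 2)⁻¹) ^ a * (fh ^ 2) ^ c * z := by
  haveI : Fact (Nat.Prime 2) := ⟨Nat.prime_two⟩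
  have hE : ((π (eh ^ 2) : SL(2, ZMod (2 ^ e))) : Matrix (Fin 2) (Fin 2) (ZMod (2 ^ e))) =
      !![1, ((2 : ℕ) : ZMod (2 ^ e)) ^ (e - 1); 0, 1] := by
    rw [Nat.cast_ofNat]; exact coe_map_eh_sq heh ht (by omega)
  have hF : ((π (fh ^ 2) : SL(2, ZMod (2 ^ e))) : Matrix (Fin 2) (Fin 2) (ZMod (2 ^ e))) =
      !![1, 0; ((2 : ℕ) : ZMod (2 ^ e)) ^ (e - 1), 1] := by
    rw [Nat.cast_ofNat]; exact coe_map_fh_sq hfh hl (by omega)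
  have hH : ((π (xh ^ 2 * eh ^ 2 * (fh ^ 2)⁻¹) : SL(2, ZMod (2 ^ e))) : Matrix (Fin 2) (Fin 2) (ZMod (2 ^ e))) =
      !![1 + ((2 : ℕ) : ZMod (2 ^ e)) ^ (e - 1), 0; 0, 1 - ((2 : ℕ) : ZMod (2 ^ e)) ^ (e - 1)] := by
    rw [Nat.cast_ofNat]; exact coe_map_h₀ heh hfh hxh ht hl he
  obtain ⟨a, b, c, habc⟩ := SL2TopLayer.exists_eq_pow_mul_pow_mul_pow 2 e (by omega) (π (eh ^ 2)) (π (fh ^ 2))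
    (π (xh ^ 2 * eh ^ 2 * (fh ^ 2)⁻¹)) hE hF hH hx
  obtain ⟨z, hz, hxz⟩ := SL2CentralExtension.exists_eq_mul_of_map_eq (π := π) (x := x)
    (y := (eh ^ 2) ^ b * (xh ^ 2 * eh ^ 2 * (fh ^ 2)⁻¹) ^ a * (fh ^ 2) ^ c)
    (by rw [habc]; simp only [map_mul, map_pow, map_inv])
  exact ⟨a, b, c, z, hz, hxz⟩

include heh in
/-- `t^{2^{e-1}} = e_h²` (`e ≥ 2`). [cite: CalegariDimitrovTang2025, §4.5, Lemma 4.5.9] -/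
theorem pow_half_eq_eh_sq (he : 2 ≤ e) : t ^ 2 ^ (e - 1) = eh * eh := by
  rw [heh, ← pow_two, ← pow_mul, ← pow_succ, show e - 2 + 1 = e - 1 by omega]

end tau

end SL2TwoPowCentralExtension

end Literature.GroupTheory.ArithmeticGroups
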